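import Literature.MathematicalPhysics.KineticTheory.HardSphereEuler
import Literature.Analysis.FunctionSpaces.BochnerProofs
import Mathlib.Analysis.SpecialFunctions.Gaussian.FourierTransform

/-!
# Negative-lane helper for `KineticWindowGronwall` (stmt-AtomisticToContinuum-9282), V: the Gaussian shell moment brick

From the standing disprover's `Cruxes/KineticWindowGronwall/Disproof.lean` §10b (cycle 2,
refuter-cdisprove-stmt-AtomisticToContinuum-9282-g2-0). Round-1 ideator 3 typed `GaussianShellMoment`
(`Cruxes/KineticWindowGronwall/IdeatorThreeSketch.lean`) as the brick that makes the dyadic shell errors of the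
Nachtergaele–Yau cut-off scheme summable inside the kinetic-window Gronwall. It is TRUE and proved here (same term,
restated so that no crux work file is imported): one fewer stub for any line through the quadratic-class re-typing.
No Theses declaration is concluded.
-/

noncomputable section

namespace Summit.AtomisticToContinuum.HydrodynamicLimit.Theorems.KineticWindowGronwallNegative

open MeasureTheory
open scoped ENNReal
open Literature.MathematicalPhysics.KineticTheory

/-- Ideator 3's brick `IdeatorThree.GaussianShellMoment` (same term, restated so that this file does not import a
crux work file): for `0 < c < 1/(2θ)` the quadratic exponential moment of the Maxwellian weight restricted to the shell
`{‖p‖ > A}` decays like `exp(−(1/(2θ) − c) A²/2)`. -/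
def GaussianShellMoment : Prop :=
  ∀ θ c : ℝ, 0 < θ → 0 < c → c < 1 / (2 * θ) → ∃ K : ℝ, 0 < K ∧ ∀ A : ℝ, 0 ≤ A →
    ∫⁻ p in {p : V3 | A < ‖p‖}, ENNReal.ofReal (Real.exp (c * ‖p‖ ^ 2 - ‖p‖ ^ 2 / (2 * θ))) ≤
      ENNReal.ofReal (K * Real.exp (-((1 / (2 * θ) - c) / 2) * A ^ 2))

/-- **`GaussianShellMoment` is TRUE** (so it is a brick, not a stub): with `κ = 1/(2θ) − c > 0`, on the shell
`e^{−κ‖p‖²} ≤ e^{−κA²/2} e^{−κ‖p‖²/2}`, and `K = ∫ e^{−κ‖p‖²/2} dp = (2π/κ)^{3/2}`. [folklore] -/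
theorem gaussianShellMoment_holds : GaussianShellMoment := by
  intro θ c hθ hc hcθ
  set κ : ℝ := 1 / (2 * θ) - c with hκ
  have hκpos : 0 < κ := by rw [hκ]; linarith
  have hb : 0 < κ / 2 := by positivity
  have hint : Integrable (fun v : V3 => Real.exp (-(κ / 2) * ‖v‖ ^ 2)) :=
    Literature.Analysis.FunctionSpaces.integrable_rexp_neg_mul_sq_norm hb
  set K : ℝ := ∫ v : V3, Real.exp (-(κ / 2) * ‖v‖ ^ 2) with hK
  have hKpos : 0 < K := by
    rw [hK, GaussianFourier.integral_rexp_neg_mul_sq_norm hb]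
    positivity
  refine ⟨K, hKpos, fun A hA => ?_⟩
  have hpt : ∀ p ∈ {p : V3 | A < ‖p‖}, ENNReal.ofReal (Real.exp (c * ‖p‖ ^ 2 - ‖p‖ ^ 2 / (2 * θ))) ≤
      ENNReal.ofReal (Real.exp (-(κ / 2) * A ^ 2) * Real.exp (-(κ / 2) * ‖p‖ ^ 2)) := by
    intro p hp
    refine ENNReal.ofReal_le_ofReal ?_
    rw [← Real.exp_add]
    refine Real.exp_le_exp.2 ?_
    have hp' : A < ‖p‖ := hp
    have hA2 : A ^ 2 ≤ ‖p‖ ^ 2 := by nlinarith [norm_nonneg p]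
    have h1 : c * ‖p‖ ^ 2 - ‖p‖ ^ 2 / (2 * θ) = -κ * ‖p‖ ^ 2 := by rw [hκ]; ring
    rw [h1]
    nlinarith [hκpos]
  calc ∫⁻ p in {p : V3 | A < ‖p‖}, ENNReal.ofReal (Real.exp (c * ‖p‖ ^ 2 - ‖p‖ ^ 2 / (2 * θ)))
      ≤ ∫⁻ p in {p : V3 | A < ‖p‖},
          ENNReal.ofReal (Real.exp (-(κ / 2) * A ^ 2) * Real.exp (-(κ / 2) * ‖p‖ ^ 2)) :=
        setLIntegral_mono' (measurableSet_lt measurable_const measurable_norm) hpt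
    _ ≤ ∫⁻ p, ENNReal.ofReal (Real.exp (-(κ / 2) * A ^ 2) * Real.exp (-(κ / 2) * ‖p‖ ^ 2)) :=
        setLIntegral_le_lintegral _ _
    _ = ENNReal.ofReal (Real.exp (-(κ / 2) * A ^ 2)) *
          ∫⁻ p, ENNReal.ofReal (Real.exp (-(κ / 2) * ‖(p : V3)‖ ^ 2)) := by
        rw [← lintegral_const_mul' _ _ ENNReal.ofReal_ne_top]
        refine lintegral_congr fun p => ?_
        rw [ENNReal.ofReal_mul (Real.exp_pos _).le]
    _ = ENNReal.ofReal (Real.exp (-(κ / 2) * A ^ 2)) * ENNReal.ofReal K := by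
        rw [hK, ofReal_integral_eq_lintegral_ofReal hint (ae_of_all _ fun v => (Real.exp_pos _).le)]
    _ = ENNReal.ofReal (K * Real.exp (-(κ / 2) * A ^ 2)) := by
        rw [← ENNReal.ofReal_mul (Real.exp_pos _).le, mul_comm]

end Summit.AtomisticToContinuum.HydrodynamicLimit.Theorems.KineticWindowGronwallNegative

end
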